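import Literature.NumberTheory.LFunctions.GaussianWeylPieceBound
import Literature.NumberTheory.LFunctions.GaussianHeckeRichertBound
import Literature.NumberTheory.LFunctions.GaussianHeckePrimeSums
import Literature.NumberTheory.LFunctions.GaussianLinePhase
import HarnessLib

/-!
# Bookkeeping for the Gaussian lattice sums: regrouping by the norm, unimodular coordinates, the phase as an
# exponential, and the smooth partition into pieces

Topic `Literature/NumberTheory/LFunctions`.  Everything here is PROVED; the definitions are explicit
(`VdC.dirZ`, `VdC.dirEZ`, `VdC.latt`, `VdC.coords` — the unimodular bases of `ℤ[i]` attached to the directions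
`VdC.dir k`; `VdC.uDir s = e^{isπ/24}`, `VdC.Rj j = 2^{j/2}/2`, `VdC.gWt`, `VdC.angP`).

* `VdC.sum_Ioc_cCoeff_mul` — `∑_{n ≤ X} c_m(n) G(n) = ∑_{0 < N z ≤ X} λ^m(z) G(N z)`;
* `VdC.sum_normLE_eq_sum_lines` — a finitely supported function summed over `ℤ[i]` equals its sum along the
  lattice lines `a ↦ a d + b e` of any of the four unimodular bases;
* `VdC.phase_eq_e` — `λ^m(z) N(z)^{-iτ} ū^{4m} = e(Im((w/2π) log(z ū)))`, `w = 4m - 2τi`;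
* `VdC.latticeSum_eq_pieces` — the smooth partition of `∑_z λ^m(z) N(z)^{-iτ} g(N z)`,
  `g(ρ) = ρ^{-1/2} (1 - ρ/x)₊³`, into the pieces `∑_z φ_{T}(z) e(F_u(z))` of `GaussianWeylPieceBound.lean`.

## References

* E. C. Titchmarsh, *The lattice-points in a circle*, Proc. London Math. Soc. (2) 38 (1935), 96–115.
  [Titchmarsh1935Lattice]
* R. M. Kaufman, Zap. Naučn. Sem. LOMI 91 (1979), 40–51. [Kaufman1979]
-/

noncomputable section

open Real Set Metric Classical Finset Complex

namespace Literature.NumberTheory.LFunctions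
namespace VdC

open GaussianInt GaussianHecke GaussianTheta

/-! ### Regrouping by the norm -/

/-- **Regrouping by the norm** with a general weight: `∑_{0 < n ≤ X} c_m(n) G(n) = ∑_{0 < N z ≤ X} λ^m(z) G(N z)`.
[folklore] -/
theorem sum_Ioc_cCoeff_mul (m : ℕ) (G : ℕ → ℂ) (X : ℕ) :
    ∑ n ∈ Finset.Ioc 0 X, cCoeff m n * G n
      = ∑ z ∈ (normLE (X : ℝ)).filter (fun z : GaussianInt => (0 : ℤ) < z.norm), angularChar m z * G z.norm.natAbs := by
  classical
  have hmaps : ∀ z ∈ (normLE (X : ℝ)).filter (fun z : GaussianInt => (0 : ℤ) < z.norm),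
      z.norm.natAbs ∈ Finset.Ioc 0 X := by
    intro z hz
    rw [Finset.mem_filter, mem_normLE] at hz
    have h0 := GaussianInt.norm_nonneg z
    have e : (z.norm.natAbs : ℤ) = z.norm := Int.natAbs_of_nonneg h0
    rw [Finset.mem_Ioc]
    constructor
    · have h1 : (0 : ℤ) < (z.norm.natAbs : ℤ) := by rw [e]; exact hz.2
      exact_mod_cast h1
    · have h1 : ((z.norm.natAbs : ℤ) : ℝ) ≤ X := by rw [e]; exact hz.1
      exact_mod_cast h1
  rw [← Finset.sum_fiberwise_of_maps_to hmaps]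
  refine Finset.sum_congr rfl fun n hn => ?_
  rw [Finset.mem_Ioc] at hn
  have hfib : ((normLE (X : ℝ)).filter (fun z : GaussianInt => (0 : ℤ) < z.norm)).filter
      (fun z => z.norm.natAbs = n) = normEq n := by
    ext z
    simp only [Finset.mem_filter, mem_normLE, mem_normEq, natAbs_norm_eq_iff]
    constructor
    · rintro ⟨-, h⟩; exact h
    · intro h
      refine ⟨⟨?_, ?_⟩, h⟩
      · rw [h]; exact_mod_cast hn.2
      · rw [h]; exact_mod_cast hn.1
  rw [hfib, cCoeff, Finset.sum_mul]
  refine Finset.sum_congr rfl fun z hz => ?_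
  rw [mem_normEq] at hz
  rw [hz]
  simp

/-! ### Unimodular coordinates -/

/-- The direction `d = dir k` as a Gaussian integer. [folklore] -/
def dirZ (k : Fin 4) : GaussianInt := ![⟨1, 0⟩, ⟨0, 1⟩, ⟨1, 1⟩, ⟨1, -1⟩] k

/-- The companion direction `e = dirE k` as a Gaussian integer. [folklore] -/
def dirEZ (k : Fin 4) : GaussianInt := ![⟨0, 1⟩, ⟨1, 0⟩, ⟨1, 0⟩, ⟨1, 0⟩] k

/-- The casts agree with `dir`, `dirE`. [folklore] -/
theorem dirZ_cast (k : Fin 4) : ((dirZ k : GaussianInt) : ℂ) = dir k ∧ ((dirEZ k : GaussianInt) : ℂ) = dirE k := by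
  fin_cases k <;> simp [dirZ, dirEZ, dir, dirE, GaussianInt.toComplex_def', Complex.ext_iff]

/-- The lattice point with coordinates `(a, b)`: `a d + b e`. [folklore] -/
def latt (k : Fin 4) (p : ℤ × ℤ) : GaussianInt := (p.1 : GaussianInt) * dirZ k + (p.2 : GaussianInt) * dirEZ k

/-- The coordinates of a lattice point in the basis `(d, e)`. [folklore] -/
def coords (k : Fin 4) (z : GaussianInt) : ℤ × ℤ :=
  ![(z.re, z.im), (z.im, z.re), (z.im, z.re - z.im), (-z.im, z.re + z.im)] k

/-- `latt ∘ coords = id`. [folklore] -/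
theorem latt_coords (k : Fin 4) (z : GaussianInt) : latt k (coords k z) = z := by
  fin_cases k <;>
    · refine Zsqrtd.ext ?_ ?_ <;> simp [latt, coords, dirZ, dirEZ]

/-- `coords ∘ latt = id`. [folklore] -/
theorem coords_latt (k : Fin 4) (p : ℤ × ℤ) : coords k (latt k p) = p := by
  obtain ⟨a, b⟩ := p
  fin_cases k <;>
    · simp [latt, coords, dirZ, dirEZ]

/-- The cast of `latt k (a, b)` is `a · dir k + b · dirE k`. [folklore] -/
theorem cast_latt (k : Fin 4) (p : ℤ × ℤ) : ((latt k p : GaussianInt) : ℂ) = (p.1 : ℂ) * dir k + (p.2 : ℂ) * dirE k := by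
  rw [latt, map_add, map_mul, map_mul, map_intCast, map_intCast, (dirZ_cast k).1, (dirZ_cast k).2]

/-- The coordinates are bounded by `|Re z| + |Im z|`. [folklore] -/
theorem abs_coords_le (k : Fin 4) (z : GaussianInt) :
    |(coords k z).1| ≤ |z.re| + |z.im| ∧ |(coords k z).2| ≤ |z.re| + |z.im| := by
  have h1 := abs_nonneg z.re
  have h2 := abs_nonneg z.im
  have h3 : |z.re - z.im| ≤ |z.re| + |z.im| := abs_sub _ _
  have h4 : |z.re + z.im| ≤ |z.re| + |z.im| := abs_add_le _ _
  have h5 : |-z.im| = |z.im| := abs_neg _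
  fin_cases k <;> refine ⟨?_, ?_⟩ <;> simp [coords] <;> linarith

/-- `|Re z| + |Im z| ≤ (3/2) ‖z‖` for a Gaussian integer (indeed `≤ √2 ‖z‖`). [folklore] -/
theorem abs_re_add_abs_im_le (z : GaussianInt) : (((|z.re| + |z.im| : ℤ)) : ℝ) ≤ 3 / 2 * ‖(z : ℂ)‖ := by
  have hre : ((z : ℂ)).re = (z.re : ℝ) := by simp
  have him : ((z : ℂ)).im = (z.im : ℝ) := by simp
  have hn : ‖(z : ℂ)‖ ^ 2 = (z.re : ℝ) ^ 2 + (z.im : ℝ) ^ 2 := by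
    rw [Complex.sq_norm, Complex.normSq_apply, hre, him]; ring
  have h0 : 0 ≤ ‖(z : ℂ)‖ := norm_nonneg _
  push_cast
  nlinarith [sq_abs (z.re : ℝ), sq_abs (z.im : ℝ), abs_nonneg (z.re : ℝ), abs_nonneg (z.im : ℝ),
    sq_nonneg (|(z.re : ℝ)| - |(z.im : ℝ)|)]

/-- **A finitely supported function summed over `ℤ[i]` equals its sum along the lines of a unimodular basis.**
If `f(z) ≠ 0` forces `‖z‖ ≤ ϱ` and (for Gaussian `z`) `N z ≤ N`, and `3ϱ/2 ≤ B`, then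
`∑_{N z ≤ N} f(z) = ∑_{|b| ≤ B} ∑_{a ∈ ℤ} f(a d + b e)`. [folklore] -/
theorem sum_normLE_eq_sum_lines (k : Fin 4) {f : ℂ → ℂ} {ϱ N : ℝ} {B : ℤ}
    (hfϱ : ∀ z : ℂ, f z ≠ 0 → ‖z‖ ≤ ϱ) (hfN : ∀ z : GaussianInt, f z ≠ 0 → (z.norm : ℝ) ≤ N)
    (hB : 3 / 2 * ϱ ≤ B) :
    ∑ z ∈ normLE N, f z = ∑ b ∈ Finset.Icc (-B) B, ∑' a : ℤ, f ((a : ℂ) * dir k + (b : ℂ) * dirE k) := by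
  classical
  set g : ℤ × ℤ → ℂ := fun p => f (latt k p) with hg
  have hgp : ∀ p, g p = f ((p.1 : ℂ) * dir k + (p.2 : ℂ) * dirE k) := fun p => by rw [hg]; dsimp only; rw [cast_latt]
  set box : Finset (ℤ × ℤ) := Finset.Icc (-B) B ×ˢ Finset.Icc (-B) B with hbox
  -- the key support property
  have key : ∀ p, g p ≠ 0 → p ∈ box ∧ latt k p ∈ normLE N := by
    intro p hp
    have hpϱ := hfϱ _ hp
    have hpN := hfN _ hp
    have hc := abs_coords_le k (latt k p)
    rw [coords_latt] at hc
    have hri := abs_re_add_abs_im_le (latt k p)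
    have hb1 : ((|p.1| : ℤ) : ℝ) ≤ B := by
      have : ((|p.1| : ℤ) : ℝ) ≤ (((|(latt k p).re| + |(latt k p).im| : ℤ)) : ℝ) := by exact_mod_cast hc.1
      linarith
    have hb2 : ((|p.2| : ℤ) : ℝ) ≤ B := by
      have : ((|p.2| : ℤ) : ℝ) ≤ (((|(latt k p).re| + |(latt k p).im| : ℤ)) : ℝ) := by exact_mod_cast hc.2
      linarith
    have hb1' : |p.1| ≤ B := by exact_mod_cast hb1
    have hb2' : |p.2| ≤ B := by exact_mod_cast hb2
    rw [abs_le] at hb1' hb2'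
    refine ⟨?_, mem_normLE.2 hpN⟩
    rw [hbox, Finset.mem_product, Finset.mem_Icc, Finset.mem_Icc]
    exact ⟨⟨hb1'.1, hb1'.2⟩, ⟨hb2'.1, hb2'.2⟩⟩
  -- RHS = sum over the box
  have hR : ∑ b ∈ Finset.Icc (-B) B, ∑' a : ℤ, f ((a : ℂ) * dir k + (b : ℂ) * dirE k) = ∑ p ∈ box, g p := by
    rw [hbox, Finset.sum_product_right]
    refine Finset.sum_congr rfl fun b hb => ?_
    rw [tsum_eq_sum (s := Finset.Icc (-B) B)]
    · exact Finset.sum_congr rfl fun a _ => (hgp (a, b)).symm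
    · intro a ha
      by_contra hne
      have := (key (a, b) (by rw [hgp]; exact hne)).1
      rw [hbox, Finset.mem_product] at this
      exact ha this.1
  -- LHS = sum over the image of `coords`
  have hinj : Set.InjOn (coords k) (normLE N : Set GaussianInt) := by
    intro z _ z' _ h
    rw [← latt_coords k z, ← latt_coords k z', h]
  have hL : ∑ z ∈ normLE N, f z = ∑ p ∈ (normLE N).image (coords k), g p := by
    rw [Finset.sum_image hinj]
    refine Finset.sum_congr rfl fun z _ => ?_
    rw [hg]; dsimp only; rw [latt_coords]
  rw [hL, hR]
  -- both are the sum over the union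
  have h1 : ∑ p ∈ (normLE N).image (coords k), g p = ∑ p ∈ (normLE N).image (coords k) ∪ box, g p := by
    refine Finset.sum_subset Finset.subset_union_left fun p _ hp => ?_
    by_contra hne
    have := (key p hne).2
    exact hp (Finset.mem_image.2 ⟨latt k p, this, coords_latt k p⟩)
  have h2 : ∑ p ∈ box, g p = ∑ p ∈ (normLE N).image (coords k) ∪ box, g p := by
    refine Finset.sum_subset Finset.subset_union_right fun p _ hp => ?_
    by_contra hne
    exact hp (key p hne).1
  rw [h1, h2]

/-! ### The phase as an exponential -/

/-- **`(z/|z|)^{4m} |z|^{-2iτ} ū^{4m} = e(Im((w/2π) log(z ū)))`**, `w = 4m - 2τi`, for `z ≠ 0`, `‖u‖ = 1`. [folklore] -/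
theorem phase_eq_e (m : ℕ) (τ : ℝ) {u z : ℂ} (hu : ‖u‖ = 1) (hz : z ≠ 0) :
    (z / (‖z‖ : ℂ)) ^ (4 * m) * (((‖z‖ ^ 2 : ℝ)) : ℂ) ^ (-(τ * I)) * (starRingEnd ℂ u) ^ (4 * m)
      = VdC.e ((logPhase (4 * m - 2 * τ * I) u z).im) := by
  have hu0 : u ≠ 0 := fun h => by rw [h, norm_zero] at hu; exact zero_ne_one hu
  set q := z * starRingEnd ℂ u with hq
  have hq0 : q ≠ 0 := mul_ne_zero hz ((map_ne_zero _).2 hu0)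
  have hqn : ‖q‖ = ‖z‖ := by rw [hq, norm_mul, Complex.norm_conj, hu, mul_one]
  have hzn : 0 < ‖z‖ := norm_pos_iff.2 hz
  set L := Complex.log q with hL
  have hexpL : Complex.exp L = q := Complex.exp_log hq0
  have hLre : L.re = Real.log ‖z‖ := by rw [hL, Complex.log_re, hqn]
  -- `e(Im((w/2π)L)) = exp(i Im(wL))`
  have h1 : VdC.e ((logPhase (4 * m - 2 * τ * I) u z).im) = Complex.exp ((((4 * m - 2 * τ * I) * L).im : ℂ) * I) := by
    rw [VdC.e, logPhase, ← hq, ← hL]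
    congr 1
    have : ((4 * (m : ℂ) - 2 * τ * I) / (2 * π) * L).im = ((4 * m - 2 * τ * I) * L).im / (2 * π) := by
      rw [div_mul_eq_mul_div, show (2 * (π : ℂ)) = ((2 * π : ℝ) : ℂ) by push_cast; ring, Complex.div_ofReal_im]
    rw [this]
    push_cast
    field_simp
  -- `Im(wL) = 4m Im L - 2τ Re L`
  have h2 : ((4 * (m : ℂ) - 2 * τ * I) * L).im = 4 * m * L.im - 2 * τ * L.re := by
    rw [Complex.mul_im]; simp; ring
  rw [h1, h2]
  -- the two factors
  have hA : (z / (‖z‖ : ℂ)) * starRingEnd ℂ u = Complex.exp ((L.im : ℂ) * I) := by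
    have hpolar : q = (‖q‖ : ℂ) * Complex.exp ((L.im : ℂ) * I) := by
      have hnq : ‖q‖ = Real.exp L.re := by rw [← hexpL, Complex.norm_exp]
      rw [hnq, Complex.ofReal_exp]
      conv_lhs => rw [← hexpL, ← Complex.re_add_im L]
      rw [Complex.exp_add]
    have hnz : (‖z‖ : ℂ) ≠ 0 := by exact_mod_cast hzn.ne'
    rw [hqn] at hpolar
    rw [div_mul_eq_mul_div, ← hq, hpolar]
    field_simp
  have hB : (((‖z‖ ^ 2 : ℝ)) : ℂ) ^ (-(τ * I)) = Complex.exp (((-(2 * τ * L.re) : ℝ) : ℂ) * I) := by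
    have hpos : (0 : ℝ) < ‖z‖ ^ 2 := by positivity
    rw [Complex.cpow_def_of_ne_zero (by exact_mod_cast hpos.ne'), ← Complex.ofReal_log hpos.le, Real.log_pow, hLre]
    congr 1
    push_cast
    ring
  calc (z / (‖z‖ : ℂ)) ^ (4 * m) * (((‖z‖ ^ 2 : ℝ)) : ℂ) ^ (-(τ * I)) * (starRingEnd ℂ u) ^ (4 * m)
      = ((z / (‖z‖ : ℂ)) * starRingEnd ℂ u) ^ (4 * m) * (((‖z‖ ^ 2 : ℝ)) : ℂ) ^ (-(τ * I)) := by rw [mul_pow]; ring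
    _ = Complex.exp ((L.im : ℂ) * I) ^ (4 * m) * Complex.exp (((-(2 * τ * L.re) : ℝ) : ℂ) * I) := by rw [hA, hB]
    _ = Complex.exp (((4 * m * L.im - 2 * τ * L.re : ℝ) : ℂ) * I) := by
        rw [← Complex.exp_nat_mul, ← Complex.exp_add]
        congr 1
        push_cast
        ring

/-- For a nonzero Gaussian integer: `λ^m(z) N(z)^{-iτ} ū^{4m} = e(Im((w/2π) log(z ū)))`. [folklore] -/
theorem gaussPhase_eq_e (m : ℕ) (τ : ℝ) {u : ℂ} (hu : ‖u‖ = 1) {z : GaussianInt} (hz : z ≠ 0) :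
    angularChar m z * (((z.norm : ℝ)) : ℂ) ^ (-(τ * I)) * (starRingEnd ℂ u) ^ (4 * m)
      = VdC.e ((logPhase (4 * m - 2 * τ * I) u z).im) := by
  have hz' : (z : ℂ) ≠ 0 := by rwa [Ne, GaussianInt.toComplex_eq_zero]
  rw [angularChar_def, GaussLine.norm_cast_eq_sq, phase_eq_e m τ hu hz']

/-! ### The radial partition -/

/-- The piece radii `R_j = 2^{j/2}/2` (`R_j² = 2^{j-2}`). [folklore] -/
def Rj (j : ℕ) : ℝ := Real.sqrt (2 ^ j) / 2

/-- `R_j² = 2^j/4` and `R_j > 0`. [folklore] -/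
theorem Rj_sq (j : ℕ) : Rj j ^ 2 = 2 ^ j / 4 ∧ 0 < Rj j := by
  have h2 : (0 : ℝ) ≤ 2 ^ j := by positivity
  refine ⟨?_, by unfold Rj; positivity⟩
  rw [Rj, div_pow, Real.sq_sqrt h2]; norm_num

/-- The dyadic windows at the radii `R_j` telescope. [folklore] -/
theorem dyadWin_Rj (j : ℕ) (ρ : ℝ) :
    dyadWin (Rj j) ρ = stepS (2 / 2 ^ j * ρ + -1) - stepS (2 / 2 ^ (j + 1) * ρ + -1) := by
  have h := (Rj_sq j).1
  have h2 : (0 : ℝ) < 2 ^ j := by positivity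
  have e1 : (1 / (2 * (2 ^ j / 4)) : ℝ) = 2 / 2 ^ j := by
    rw [div_eq_div_iff (by positivity) h2.ne']; ring
  have e2 : (1 / (4 * (2 ^ j / 4)) : ℝ) = 2 / 2 ^ (j + 1) := by
    rw [div_eq_div_iff (by positivity) (by positivity), pow_succ]; ring
  rw [dyadWin, h, e1, e2]

/-- **The radial partition of unity**: `∑_{j ≤ J} χ_{R_j}(ρ) = 1` for `1 ≤ ρ ≤ 2^J`. [folklore] -/
theorem sum_dyadWin_eq_one {ρ : ℝ} {J : ℕ} (h1 : 1 ≤ ρ) (h2 : ρ ≤ 2 ^ J) :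
    ∑ j ∈ Finset.range (J + 1), dyadWin (Rj j) ρ = 1 := by
  simp_rw [dyadWin_Rj]
  rw [Finset.sum_range_sub' (fun j => stepS (2 / 2 ^ j * ρ + -1))]
  rw [stepS_of_one_le (by simp; linarith), stepS_of_nonpos, sub_zero]
  have hJ : (0 : ℝ) < 2 ^ (J + 1) := by positivity
  rw [pow_succ] at hJ ⊢
  rw [div_mul_eq_mul_div, div_add' _ _ _ hJ.ne', div_nonpos_iff]
  right; constructor <;> nlinarith

/-! ### The angular partition -/

/-- The piece directions `u_s = e^{isπ/24}` for integer `s`. [folklore] -/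
def uDirZ (s : ℤ) : ℂ := Complex.exp ((((s : ℝ) * π / 24 : ℝ)) * I)

/-- The piece directions `u_s = e^{isπ/24}`, `s ∈ ℕ`. [folklore] -/
def uDir (s : ℕ) : ℂ := uDirZ s

/-- `‖u_s‖ = 1`. [folklore] -/
theorem norm_uDirZ (s : ℤ) : ‖uDirZ s‖ = 1 := by
  rw [uDirZ, Complex.norm_exp_ofReal_mul_I]

/-- `‖u_s‖ = 1`. [folklore] -/
theorem norm_uDir (s : ℕ) : ‖uDir s‖ = 1 := by rw [uDir, show ((s : ℕ) : ℤ) = (s : ℤ) from rfl]; exact norm_uDirZ s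

/-- `u_{s + 48k} = u_s`. [folklore] -/
theorem uDirZ_add (s k : ℤ) : uDirZ (s + 48 * k) = uDirZ s := by
  rw [uDirZ, uDirZ]
  have : ((((s + 48 * k : ℤ) : ℝ) * π / 24 : ℝ) : ℂ) * I = (((s : ℝ) * π / 24 : ℝ) : ℂ) * I + (k : ℂ) * (2 * π * I) := by
    push_cast; ring
  rw [this, Complex.exp_add, Complex.exp_int_mul_two_pi_mul_I, mul_one]

/-- The conjugate direction: `conj u_s = u_{-s}`, and its argument as an angle is `-sπ/24`. [folklore] -/
theorem conj_uDirZ (s : ℤ) : starRingEnd ℂ (uDirZ s) = uDirZ (-s) ∧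
    (Complex.arg (uDirZ (-s)) : Real.Angle) = ((-((s : ℝ) * π / 24) : ℝ) : Real.Angle) := by
  constructor
  · rw [uDirZ, uDirZ, ← Complex.exp_conj, map_mul, Complex.conj_ofReal, Complex.conj_I]
    congr 1; push_cast; ring
  · rw [uDirZ, Complex.arg_exp, Real.Angle.coe_toIocMod]
    congr 1
    simp; ring

/-- The angular bumps `P_p(z) = S((-1)^p cos(24 arg z) + 1/2)`, `p = 0, 1`. [folklore] -/
def angP (p : ℕ) (z : ℂ) : ℝ := stepS ((-1) ^ p * Real.cos (24 * Complex.arg z) + 1 / 2)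

/-- `P_0 + P_1 = 1`. [folklore] -/
theorem angP_add (z : ℂ) : angP 0 z + angP 1 z = 1 := by
  rw [angP, angP, pow_zero, one_mul, pow_one, neg_one_mul,
    show -Real.cos (24 * Complex.arg z) + 1 / 2 = 1 - (Real.cos (24 * Complex.arg z) + 1 / 2) by ring]
  exact stepS_add_stepS_one_sub _

/-- The angular coordinate of `z` relative to `u_s`: `cos(24 A_{u_s}(z)) = (-1)^s cos(24 arg z)`. [folklore] -/
theorem cos_angA_uDirZ (s : ℤ) {z : ℂ} (hz : z ≠ 0) :
    Real.cos (24 * angA (uDirZ s) z) = (-1) ^ s * Real.cos (24 * Complex.arg z) := by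
  rw [angA_eq_arg, (conj_uDirZ s).1]
  have hu0 : uDirZ (-s) ≠ 0 := by
    intro h; have := norm_uDirZ (-s); rw [h, norm_zero] at this; exact zero_ne_one this
  have hang := Complex.arg_mul_coe_angle hz hu0
  rw [(conj_uDirZ s).2, ← Real.Angle.coe_add, Real.Angle.angle_eq_iff_two_pi_dvd_sub] at hang
  obtain ⟨k, hk⟩ := hang
  have : Complex.arg (z * uDirZ (-s)) = Complex.arg z - s * π / 24 + 2 * π * k := by linarith
  rw [this, show 24 * (Complex.arg z - s * π / 24 + 2 * π * k) = 24 * Complex.arg z - s * π + (24 * k : ℤ) * (2 * π) by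
      push_cast; ring, Real.cos_add_int_mul_two_pi, Real.cos_sub_int_mul_pi]

/-- **The smooth weight at the piece directions depends only on the parity of `s`**:
`wt x R u_s z = g₀(|z|²) P_{s mod 2}(z)`. [folklore] -/
theorem wt_uDir (x R : ℝ) (s : ℕ) {z : ℂ} (hz : z ≠ 0) : wt x R (uDir s) z = radProf x R (‖z‖ ^ 2) * angP (s % 2) z := by
  rw [wt, angB, angP, uDir, cos_angA_uDirZ s hz, zpow_natCast, neg_one_pow_eq_pow_mod_two]

/-- The quotient of two piece directions. [folklore] -/
theorem uDirZ_mul_conj (s s' : ℤ) : uDirZ s * starRingEnd ℂ (uDirZ s') = uDirZ (s - s') := by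
  rw [(conj_uDirZ s').1, uDirZ, uDirZ, uDirZ, ← Complex.exp_add]
  congr 1; push_cast; ring

/-- **Uniqueness of the sector**: a point lies in at most one trapezoid `pieceT u_s R` of a given parity of `s`,
`s < 48`. [folklore] -/
theorem pieceT_uDir_unique {R : ℝ} (hR : 0 < R) {s s' : ℕ} (hs : s < 48) (hs' : s' < 48) (hpar : s % 2 = s' % 2)
    {z : ℂ} (h1 : z ∈ pieceT (uDir s) R) (h2 : z ∈ pieceT (uDir s') R) : s = s' := by
  set q := z * starRingEnd ℂ (uDir s) with hq
  set q' := z * starRingEnd ℂ (uDir s') with hq'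
  have hre : 0 < q.re := hR.trans_le h1.1
  have hre' : 0 < q'.re := hR.trans_le h2.1
  have harg : |Complex.arg q| < π / 24 := abs_arg_lt_of_cone hre (h1.2.2.trans (by nlinarith))
  have harg' : |Complex.arg q'| < π / 24 := abs_arg_lt_of_cone hre' (h2.2.2.trans (by nlinarith))
  have hq0 : q ≠ 0 := fun h => by rw [h] at hre; simp at hre
  -- `q' = q · u_{s - s'}`
  have hν : q' = q * uDirZ ((s : ℤ) - s') := by
    have h1' : starRingEnd ℂ (uDir s) * uDir s = 1 := by
      rw [mul_comm, Complex.mul_conj, Complex.normSq_eq_norm_sq, norm_uDir]; simp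
    rw [hq', hq, mul_assoc, ← uDirZ_mul_conj, uDir, uDir, show (z * (starRingEnd ℂ (uDirZ s) * (uDirZ s * starRingEnd ℂ (uDirZ s')))) = z * ((starRingEnd ℂ (uDirZ ↑s) * uDirZ ↑s)) * starRingEnd ℂ (uDirZ ↑s') by ring]
    rw [uDir] at h1'
    rw [h1', mul_one]
  have hν0 : uDirZ ((s : ℤ) - s') ≠ 0 := by
    intro h; have := norm_uDirZ ((s : ℤ) - s'); rw [h, norm_zero] at this; exact zero_ne_one this
  have hang := Complex.arg_mul_coe_angle hq0 hν0
  rw [← hν] at hang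
  have hargν : (Complex.arg (uDirZ ((s : ℤ) - s')) : Real.Angle) = ((((s : ℤ) - s' : ℤ) : ℝ) * π / 24 : ℝ) := by
    rw [uDirZ, Complex.arg_exp, Real.Angle.coe_toIocMod]; congr 1; simp
  rw [hargν, ← Real.Angle.coe_add, Real.Angle.angle_eq_iff_two_pi_dvd_sub] at hang
  obtain ⟨k, hk⟩ := hang
  have hπ := Real.pi_pos
  -- `|(s - s') + 48 k| < 2`
  have hlt : |((((s : ℤ) - s' : ℤ) : ℝ)) + 48 * k| < 2 := by
    have e1 : ((((s : ℤ) - s' : ℤ) : ℝ)) + 48 * k = (24 / π) * (Complex.arg q' - Complex.arg q) := by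
      have : Complex.arg q' - Complex.arg q = (((s : ℤ) - s' : ℤ) : ℝ) * π / 24 + 2 * π * k := by linarith
      rw [this]; field_simp; ring
    rw [e1, abs_mul, abs_of_pos (by positivity)]
    have : |Complex.arg q' - Complex.arg q| < π / 12 := by
      have := abs_sub (Complex.arg q') (Complex.arg q); linarith
    calc 24 / π * |Complex.arg q' - Complex.arg q| < 24 / π * (π / 12) := by gcongr
      _ = 2 := by field_simp; ring
  have hint : |((s : ℤ) - s') + 48 * k| < 2 := by
    have : ((|((s : ℤ) - s') + 48 * k| : ℤ) : ℝ) < 2 := by push_cast; push_cast at hlt; exact hlt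
    exact_mod_cast this
  rw [abs_lt] at hint
  omega

/-- **Existence of the sector**: if `g₀(|z|²) P_p(z) ≠ 0` then `z` lies in some `pieceT u_s R` with `s ≡ p (2)`,
`s < 48`. [folklore] -/
theorem exists_pieceT_uDir {x R : ℝ} (hR : 0 < R) {p : ℕ} (hp : p < 2) {z : ℂ} (hz : z ≠ 0)
    (hne : radProf x R (‖z‖ ^ 2) * angP p z ≠ 0) : ∃ s : ℕ, s < 48 ∧ s % 2 = p ∧ z ∈ pieceT (uDir s) R := by
  have hπ := Real.pi_pos
  set θ := Complex.arg z with hθ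
  set n : ℤ := round ((24 * θ / π - p) / 2) with hn
  set s₀ : ℤ := 2 * n + p with hs₀
  -- what the non-vanishing says
  have hrad : 2 * R ^ 2 < ‖z‖ ^ 2 ∧ ‖z‖ ^ 2 < 8 * R ^ 2 := by
    by_contra hcon
    refine hne ?_
    rw [radProf_eq_zero hR (by rw [not_and_or, not_lt, not_lt] at hcon; exact hcon), zero_mul]
  have hang : -(1 / 2) < (-1) ^ p * Real.cos (24 * θ) := by
    by_contra hcon
    refine hne ?_
    rw [angP, stepS_of_nonpos (by push Not at hcon; linarith), mul_zero]
  -- the angle `ψ = θ - s₀ π/24`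
  set ψ := θ - s₀ * π / 24 with hψ
  have hψ1 : |ψ| ≤ π / 24 := by
    have hr := abs_sub_round ((24 * θ / π - p) / 2)
    rw [← hn] at hr
    have e : ψ = (π / 12) * ((24 * θ / π - p) / 2 - n) := by
      rw [hψ, hs₀]; push_cast; field_simp; ring
    rw [e, abs_mul, abs_of_pos (by positivity)]
    calc π / 12 * |(24 * θ / π - ↑p) / 2 - ↑n| ≤ π / 12 * (1 / 2) := by gcongr
      _ = π / 24 := by ring
  have hcosψ : Real.cos (24 * ψ) = (-1) ^ p * Real.cos (24 * θ) := by
    rw [hψ, hs₀, show 24 * (θ - ((2 * n + p : ℤ) : ℝ) * π / 24) = 24 * θ - p * π - n * (2 * π) by push_cast; ring,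
      Real.cos_sub_int_mul_two_pi, Real.cos_sub_nat_mul_pi]
  have hψ2 : |ψ| < π / 36 := abs_lt_of_cos24 hψ1 (by rw [hcosψ]; exact hang)
  obtain ⟨hc, hs⟩ := cos_sin_small hψ2
  -- the sector index
  set s : ℕ := (s₀ % 48).toNat with hsdef
  have hs48 : (s : ℤ) = s₀ % 48 := by rw [hsdef, Int.toNat_of_nonneg (Int.emod_nonneg _ (by norm_num))]
  have hslt : s < 48 := by
    have : (s : ℤ) < 48 := by rw [hs48]; exact Int.emod_lt_of_pos _ (by norm_num)
    omega
  have hsp : s % 2 = p := by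
    have h1 : (s : ℤ) % 2 = (p : ℤ) % 2 := by
      rw [hs48, Int.emod_emod_of_dvd _ (by norm_num : (2 : ℤ) ∣ 48), hs₀]; omega
    have h2 : (p : ℤ) % 2 = p := by omega
    omega
  -- `uDir s = uDirZ s₀`
  have hus : uDir s = uDirZ s₀ := by
    rw [uDir, hs48, show s₀ % 48 = s₀ + 48 * (-(s₀ / 48)) by omega, uDirZ_add]
  refine ⟨s, hslt, hsp, ?_⟩
  rw [hus]
  -- `q = z conj(u_{s₀}) = ‖z‖ e^{iψ}`
  have hzn : 0 < ‖z‖ := norm_pos_iff.2 hz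
  have hq : z * starRingEnd ℂ (uDirZ s₀) = (‖z‖ : ℂ) * Complex.exp ((ψ : ℂ) * I) := by
    rw [(conj_uDirZ s₀).1, uDirZ]
    conv_lhs => rw [← Complex.norm_mul_exp_arg_mul_I z]
    rw [← hθ, mul_assoc, ← Complex.exp_add, hψ]
    congr 2; push_cast; ring
  have hqre : (z * starRingEnd ℂ (uDirZ s₀)).re = ‖z‖ * Real.cos ψ := by
    rw [hq, Complex.re_ofReal_mul, Complex.exp_ofReal_mul_I_re]
  have hqim : (z * starRingEnd ℂ (uDirZ s₀)).im = ‖z‖ * Real.sin ψ := by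
    rw [hq, Complex.im_ofReal_mul, Complex.exp_ofReal_mul_I_im]
  have hzl : 141 / 100 * R < ‖z‖ := by nlinarith [hrad.1]
  have hzu : ‖z‖ < 283 / 100 * R := by nlinarith [hrad.2]
  refine ⟨?_, ?_, ?_⟩
  · show R ≤ (z * starRingEnd ℂ (uDirZ s₀)).re
    rw [hqre]; nlinarith
  · show (z * starRingEnd ℂ (uDirZ s₀)).re ≤ 4 * R
    rw [hqre]; nlinarith [Real.cos_le_one ψ]
  · show |(z * starRingEnd ℂ (uDirZ s₀)).im| ≤ 1 / 9 * (z * starRingEnd ℂ (uDirZ s₀)).re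
    rw [hqre, hqim, abs_mul, abs_norm]
    calc ‖z‖ * |Real.sin ψ| ≤ ‖z‖ * (9 / 100) := by gcongr
      _ ≤ 1 / 9 * (‖z‖ * Real.cos ψ) := by nlinarith

/-- **The sum over the sectors**: `∑_{k < 24} φ_{T(u_{2k+p})}(z) = g₀(|z|²) P_p(z)` for `z ≠ 0`. [folklore] -/
theorem sum_pwt_uDir (x : ℝ) {R : ℝ} (hR : 0 < R) {p : ℕ} (hp : p < 2) {z : ℂ} (hz : z ≠ 0) :
    ∑ k ∈ Finset.range 24, pwt x R (uDir (2 * k + p)) z = radProf x R (‖z‖ ^ 2) * angP p z := by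
  have hterm : ∀ k ∈ Finset.range 24, pwt x R (uDir (2 * k + p)) z
      = if z ∈ pieceT (uDir (2 * k + p)) R then radProf x R (‖z‖ ^ 2) * angP p z else 0 := by
    intro k _
    rw [pwt]
    split_ifs with h
    · rw [wt_uDir x R _ hz, show (2 * k + p) % 2 = p by omega]
    · rfl
  rw [Finset.sum_congr rfl hterm]
  by_cases hne : radProf x R (‖z‖ ^ 2) * angP p z = 0
  · rw [hne]; simp
  · obtain ⟨s, hs48, hsp, hsT⟩ := exists_pieceT_uDir hR hp hz hne
    have hk₀ : s / 2 ∈ Finset.range 24 := by rw [Finset.mem_range]; omega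
    have hs2 : 2 * (s / 2) + p = s := by omega
    rw [Finset.sum_eq_single (s / 2)]
    · rw [hs2, if_pos hsT]
    · intro k hk hks
      rw [if_neg]
      intro hkT
      have := pieceT_uDir_unique hR (by rw [Finset.mem_range] at hk; omega) hs48 (by omega) hkT hsT
      omega
    · intro h; exact absurd hk₀ h

/-! ### The partition into pieces -/

/-- The weight `g₀(ρ) = ρ^{-1/2} (1 - ρ/x)₊³` of the smoothed partial sums. [folklore] -/
def gWt (x ρ : ℝ) : ℝ := rsq ρ * rz x ρ

/-- `radProf x R ρ = g₀(ρ) χ_R(ρ)`. [folklore] -/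
theorem radProf_eq (x R ρ : ℝ) : radProf x R ρ = gWt x ρ * dyadWin R ρ := rfl

/-- The nonzero Gaussian integers of norm `≤ X`. [folklore] -/
def lattZ (X : ℕ) : Finset GaussianInt := (normLE (X : ℝ)).filter (fun z : GaussianInt => (0 : ℤ) < z.norm)

/-- Membership in `lattZ`. [folklore] -/
theorem mem_lattZ {X : ℕ} {z : GaussianInt} : z ∈ lattZ X ↔ (z.norm : ℝ) ≤ X ∧ (0 : ℤ) < z.norm := by
  rw [lattZ, Finset.mem_filter, mem_normLE]

/-- **The partition into pieces**: for `X ≤ 2^J`,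
`∑_{0 < N z ≤ X} λ^m(z) N(z)^{-iτ} g₀(N z) = ∑_{j ≤ J} ∑_{p < 2} ∑_{k < 24} u^{4m} ∑_z φ_{T_{j,s}}(z) e(F_{u_s}(z))`,
`u = u_s`, `s = 2k + p`, `w = 4m - 2τ i`. [folklore] -/
theorem latticeSum_eq_pieces (m : ℕ) (τ : ℝ) (x : ℝ) {X J : ℕ} (hXJ : (X : ℝ) ≤ 2 ^ J) :
    ∑ z ∈ lattZ X, angularChar m z * (((z.norm : ℝ)) : ℂ) ^ (-(τ * I)) * ((gWt x z.norm : ℝ) : ℂ)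
      = ∑ j ∈ Finset.range (J + 1), ∑ p ∈ Finset.range 2, ∑ k ∈ Finset.range 24,
          uDir (2 * k + p) ^ (4 * m) *
            ∑ z ∈ lattZ X, (pwt x (Rj j) (uDir (2 * k + p)) z : ℂ) *
              VdC.e ((logPhase (4 * m - 2 * τ * I) (uDir (2 * k + p)) z).im) := by
  -- pointwise in `z`
  have hpt : ∀ z : GaussianInt, z ∈ lattZ X →
      (angularChar m z * (((z.norm : ℝ)) : ℂ) ^ (-(τ * I)) * ((gWt x z.norm : ℝ) : ℂ)
        = ∑ j ∈ Finset.range (J + 1), ∑ p ∈ Finset.range 2, ∑ k ∈ Finset.range 24,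
            uDir (2 * k + p) ^ (4 * m) * ((pwt x (Rj j) (uDir (2 * k + p)) z : ℂ) *
              VdC.e ((logPhase (4 * m - 2 * τ * I) (uDir (2 * k + p)) z).im))) := by
    intro z hz
    rw [mem_lattZ] at hz
    have hz0 : z ≠ 0 := fun h => by rw [h] at hz; simp at hz
    have hz' : (z : ℂ) ≠ 0 := by rwa [Ne, GaussianInt.toComplex_eq_zero]
    have hN : ((z.norm : ℝ)) = ‖(z : ℂ)‖ ^ 2 := GaussLine.norm_cast_eq_sq z
    have hN1 : (1 : ℝ) ≤ z.norm := by exact_mod_cast hz.2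
    set Φ : ℂ := angularChar m z * (((z.norm : ℝ)) : ℂ) ^ (-(τ * I)) with hΦ
    have hpiece : ∀ (j s : ℕ), uDir s ^ (4 * m) * ((pwt x (Rj j) (uDir s) z : ℂ) *
        VdC.e ((logPhase (4 * m - 2 * τ * I) (uDir s) z).im)) = (pwt x (Rj j) (uDir s) z : ℂ) * Φ := by
      intro j s
      rw [← gaussPhase_eq_e m τ (norm_uDir s) hz0, ← hΦ]
      have h1 : starRingEnd ℂ (uDir s) ^ (4 * m) * uDir s ^ (4 * m) = 1 := by
        rw [← mul_pow, mul_comm, Complex.mul_conj, Complex.normSq_eq_norm_sq, norm_uDir]; simp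
      linear_combination ((pwt x (Rj j) (uDir s) z : ℂ) * Φ) * h1
    simp_rw [hpiece]
    rw [show ∑ j ∈ Finset.range (J + 1), ∑ p ∈ Finset.range 2, ∑ k ∈ Finset.range 24,
          (pwt x (Rj j) (uDir (2 * k + p)) z : ℂ) * Φ
        = ((∑ j ∈ Finset.range (J + 1), ∑ p ∈ Finset.range 2, ∑ k ∈ Finset.range 24,
            pwt x (Rj j) (uDir (2 * k + p)) z : ℝ) : ℂ) * Φ by
      push_cast; simp_rw [Finset.sum_mul]]
    have hang : ∀ j ∈ Finset.range (J + 1), ∑ p ∈ Finset.range 2, ∑ k ∈ Finset.range 24,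
        pwt x (Rj j) (uDir (2 * k + p)) z = radProf x (Rj j) (‖(z : ℂ)‖ ^ 2) := by
      intro j _
      rw [Finset.sum_range_succ, Finset.sum_range_one, sum_pwt_uDir x (Rj_sq j).2 (by norm_num) hz',
        sum_pwt_uDir x (Rj_sq j).2 (by norm_num) hz', ← mul_add, angP_add, mul_one]
    rw [Finset.sum_congr rfl hang]
    simp_rw [radProf_eq, ← Finset.mul_sum]
    rw [sum_dyadWin_eq_one (by rw [← hN]; exact hN1) (by rw [← hN]; exact hz.1.trans hXJ), mul_one, hN, hΦ]
    push_cast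
    ring
  -- rearrange the sums
  rw [Finset.sum_congr rfl hpt, Finset.sum_comm]
  refine Finset.sum_congr rfl fun j _ => ?_
  rw [Finset.sum_comm]
  refine Finset.sum_congr rfl fun p _ => ?_
  rw [Finset.sum_comm]
  refine Finset.sum_congr rfl fun k _ => ?_
  rw [Finset.mul_sum]


end VdC
end Literature.NumberTheory.LFunctions

end
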